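import Summits.BirchSwinnertonDyer.BirchSwinnertonDyer.Theorems.ClassRecordThreeEulerHalvesAtThreeCartanCarayolLift
import HarnessLib

/-!
# `Lines/cartan_carayol.lean` — r5 (bsd-idea-10 g20, lens = transfer): the Carayol ∕ congruent-newform ∕ LIFT line of the Galois leaf OBS, THIN

Crux dir `Cruxes/EulerHalvesAtThree/` (stmt-BirchSwinnertonDyer-19109), serving the child NUM stmt-BirchSwinnertonDyer-24801
`ClassRecordThree.CartanOnePlaceDegreeLawAtThree` through its Galois leaf OBS = `CartanCover.Charext.NoModThreePeriodCharacterExtension`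
(`Theorems/…CartanCoverDockedLineSaturation.lean`). NOT REGISTERED (W-79: the LEAD tam3-p1 holds the line of record `Cruxes/CartanOnePlaceDegreeLawAtThree/
Lines/lattice.lean`); this is a published work-file whose two stubs are offered to the LEAD's v9 by NAME.

WHAT CHANGED SINCE r3.1 (f47851bb8497). Everything r3.1 restated locally is now TREE: CAR (p739037 `…CartanCarayolCut`), MOD + CONG + `CONG → MOD → CAR → OBS`
(p740349 `…CartanCarayolModular`), and — new this generation — the LIFT socket (p741779 r1 ∕ p742701 r2 `…CartanCarayolLift`): (LIFT′)
`CartanCarayol.CuspidalEigenCochainLiftPrimeToCartanPlaceAtThree` (print: Armstrong + Eichler–Shimura `H¹_P` + Deligne–Serre 6.11 + Jacquet–Langlands (`D > 1`) ∕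
Casselman + Atkin–Lehner, typed over `coverUnits X q`, `InertHecke.HeckeDatum`, `InertHecke.unitsHeckeSet`, `Matrix.GeneralLinearGroup.IsParabolic`; nothing
asserted), (EIG′) `CartanCarayol.PeriodCharacterCuspidalEigenPackageAtThree` (the inert-Hecke certificate's OUTPUT: CONG's binders ⊢ a non-zero `3`-torsion additive
`T_ℓ`-eigen cochain package on the cover, null on torsion AND ON PARABOLIC elements; provable from parts A p739840 ∕ B p740670 ∕ C p741333 + (SIMREP) + (CHEB,
proved p741814) + RED_ℓ (p742058) + (PAR) [PROVED p744112 `…CartanCarayolParabolic`] — the LEAD's glue (b)), and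
`CartanCarayol.congruentNewform_of_cuspLift : LIFT′ → EIG′ → CONG`,
`…noModThreePeriodCharacterExtension_of_cuspLift : thm61 → LIFT′ → EIG′ → OBS`. CRITIC V214 (2026-08-29): r1's LIFT (no parabolic clause) is FALSE at `D = 1`
(Eisenstein eigen-cochains on `Γ₀(11)`); it stays in the tree deprecated (append-only) and is NEVER a stub here.
So r5 is thin: the stubs are the two r2 tree conjecture decls BY NAME, the composition is the tree theorem BY NAME. r5 = r4 minus §1b, which is now TREE
(p744112 `Theorems/…CartanCarayolParabolic.lean`, ns `…Theorems.CartanCarayol`: `pow_two_mul_mem_principalLevel_of_isParabolic`, (PAR)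
`segmentIntegral_smul_eq_zero_of_isParabolic`, and the whole parabolic conjunct of (EIG′) in (OBS) currency `exists_eq_three_mul_of_isParabolic`).

* §1 (PROVED, SIMREP side; kept here rather than in Theorems to avoid orphan decls): `IsCoverHeckeOperator` = LIFT's two representative clauses as a
  predicate; `gamma_mul_mem_unitsHeckeSet_coverOrder : γ ∈ Γ → a ∈ ι(O(n)) → γ·a ∈ unitsHeckeSet (cover order) n`;
  `isCoverHeckeOperator_ofStable_changeReps`: the `ofStable ((gammaHeckeDatum X n).changeReps g)` datum of (SIMREP) clauses (i)–(ii) satisfies the two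
  clauses as soon as clause (iv) of `InertHecke.SimultaneousHeckeReps` holds (verbatim) — i.e. the LEAD's (b) gets LIFT∕EIG's datum clauses for free.
* (former §1b — the parabolic clause of (EIG′) — is TREE since p744112: `CartanCarayol.exists_eq_three_mul_of_isParabolic` gives, from the three literal
  hypotheses of (OBS) on `(c, χ)` and `q ∈ C` prime `≠ 3`, `∃ y ∈ Λ, χ x = 3y` for every parabolic `x ∈ coverUnits X q`; the LEAD reads it as `χ̄ x = 0` through
  `InertHecke.redThree_eq_zero_iff` (part C). Its inputs `pow_two_mul_mem_principalLevel_of_isParabolic` and (PAR) `segmentIntegral_smul_eq_zero_of_isParabolic`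
  (periods of ANY `CuspForm Γ 2`, `Γ ≤ SL₂(ℝ)`, over parabolic `β ∈ Γ` vanish) are proved there.)
* §2 STUBS (2): `stub_cuspidalEigenCochainLiftPrimeToCartanPlaceAtThree : LIFT′` (print, cite-conjunct grade),
  `stub_periodCharacterCuspidalEigenPackageAtThree : EIG′` (certificate; the LEAD's (b) replaces this stub by a proof).
* §3 COMPOSITION BY NAME (sorry-free given the stubs): CONG, MOD, CAR, OBS, `SaturationAtThree` — `noModThreePeriodCharacterExtension_of_stubs (h61)`.

HONEST: two `sorry`s (the stubs), no closure claim; OBS ∕ CONG ∕ MOD ∕ CAR ∕ LIFT′ ∕ EIG′ ∕ 24801 ∕ 23422 ∕ 19109 open; BSD is proved for no curve.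
Memo: `Cruxes/EulerHalvesAtThree/LIFT-TRANSFER.md` (transfer dictionary vs. `exists_isNewform0_of_eigenvector_mod`, labelled leaf census).
[cite: ShimuraIATAF1971, Thm. 8.4, §8.3] [cite: DeligneSerre1974, Lemme 6.11, Thm. 6.1] [cite: JacquetLanglands1970, §16] [cite: Casselman1973, Thm. 1]
[cite: Carayol1989, Thm. (A)] [cite: DiamondTaylor1994, §1–§4]
-/

set_option linter.dupNamespace false
set_option autoImplicit false

noncomputable section

open scoped Classical MatrixGroups ModularForm NumberField

namespace Summit.BirchSwinnertonDyer.BirchSwinnertonDyer.Cruxes.EulerHalvesAtThree.Carayol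

open Summit.BirchSwinnertonDyer.BirchSwinnertonDyer.Theorems
open Summit.BirchSwinnertonDyer.BirchSwinnertonDyer.Theorems.CartanCover.Charext
open Summit.BirchSwinnertonDyer.BirchSwinnertonDyer.Theorems.CartanCover.Charext.InertHecke
open Literature.NumberTheory.Automorphic WeierstrassCurve Literature.NumberTheory.EllipticCurves
open Literature.NumberTheory.EllipticCurves.ModularForms Literature.NumberTheory.EllipticCurves.Rank1Residual
open NumberField IsDedekindDomain CongruenceSubgroup Rat.HeightOneSpectrum

variable {D M : ℕ} {C : Finset ℕ}

/-! ## §1 «`H` is the Hecke operator `T_n` of the cover curve» -/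

/-- **`H` IS `T_n` OF THE COVER `ι(O₀'¹)∖ℍ`**: the representatives of the Hecke datum `H` on `coverUnits X q = ι(O₀'¹)` lie in `ι(O₀'(n))`
(`InertHecke.unitsHeckeSet` of the cover order) and every element of `ι(O₀'(n))` is left-`ι(O₀'¹)`-equivalent to one of them. With `H.disj` the `α i`
are then a complete family of representatives of `ι(O₀'¹)∖ι(O₀'(n))`, and `H.op` on additive cochains is the Hecke operator `T_n` of
`H¹(ι(O₀'¹), ·)` whatever the choices ((T8) `HeckeDatum.op_changeReps`). [cite: ShimuraIATAF1971, §3.1–§3.4, §8.3] -/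
def IsCoverHeckeOperator (X : CartanLevelCurveData D M C) (q n : ℕ) {ι : Type*}
    (H : HeckeDatum (CartanCover.coverUnits X q) ι) : Prop :=
  (∀ i, H.α i ∈ unitsHeckeSet X.ι (O := CartanCover.coverOrder X q) n) ∧
    ∀ a ∈ unitsHeckeSet X.ι (O := CartanCover.coverOrder X q) n, ∃ i, ∃ u ∈ CartanCover.coverUnits X q, u * a = H.α i

/-- `Γ · ι(O(n)) ⊆ ι(O₀'(n))`: a `Γ = ι(O¹)`-translate of an element of `ι(O(n))` lies in the norm-`n` set of the cover order `O₀' ⊇ O`. [folklore] -/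
theorem gamma_mul_mem_unitsHeckeSet_coverOrder (X : CartanLevelCurveData D M C) (q : ℕ) {n : ℕ} {γ a : GL (Fin 2) ℝ}
    (hγ : γ ∈ X.Gamma) (ha : a ∈ X.heckeSet n) :
    γ * a ∈ unitsHeckeSet X.ι (O := CartanCover.coverOrder X q) n := by
  obtain ⟨⟨x, hx, hxγ⟩, -, hγ1⟩ := hγ
  obtain ⟨⟨y, hy, hya⟩, hdet⟩ := ha
  refine ⟨⟨x * y, (CartanCover.isOrder_coverOrder X q).mul_mem _ (CartanCover.le_coverOrder X q hx) _
    (CartanCover.le_coverOrder X q hy), ?_⟩, ?_⟩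
  · rw [map_mul, hxγ, hya, Units.val_mul]
  · rw [Units.val_mul, Matrix.det_mul, hdet, ← Matrix.GeneralLinearGroup.val_det_apply, hγ1, Units.val_one, one_mul]

/-- **the certificate's datum IS `T_ℓ` of the cover**: the `ofStable` datum on `ι(O₀'¹)` built from `Γ`-translates `g i · q_i.out` of the tree's
representatives of `Γ∖ι(O(ℓ))` (the shape delivered by (SIMREP) `InertHecke.SimultaneousHeckeReps`, clauses (i), (ii)) satisfies
`IsCoverHeckeOperator` as soon as the family meets every `ι(O₀'¹)`-coset of `ι(O₀'(ℓ))` (clause (iv) of (SIMREP), verbatim). [folklore] -/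
theorem isCoverHeckeOperator_ofStable_changeReps (X : CartanLevelCurveData D M C) (q n : ℕ) [Fintype (Quotient (X.heckeSetoid n))]
    (g : Quotient (X.heckeSetoid n) → X.Gamma)
    (disjU : ∀ (i j : Quotient (X.heckeSetoid n)) (u : GL (Fin 2) ℝ), u ∈ CartanCover.coverUnits X q →
      ((gammaHeckeDatum X n).changeReps g).α i = u * ((gammaHeckeDatum X n).changeReps g).α j → i = j)
    (stabU : ∀ (u : CartanCover.coverUnits X q) (i : Quotient (X.heckeSetoid n)), ∃ j,
      ((gammaHeckeDatum X n).changeReps g).α i * u * (((gammaHeckeDatum X n).changeReps g).α j)⁻¹ ∈ CartanCover.coverUnits X q)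
    (hcov : ∀ a ∈ unitsHeckeSet X.ι (O := CartanCover.coverOrder X q) n, ∃ (i : Quotient (X.heckeSetoid n)),
      ∃ u ∈ CartanCover.coverUnits X q, u * a = (g i : GL (Fin 2) ℝ) * ((i.out : X.heckeSet n) : GL (Fin 2) ℝ)) :
    IsCoverHeckeOperator X q n
      (HeckeDatum.ofStable (Γ := CartanCover.coverUnits X q) ((gammaHeckeDatum X n).changeReps g).α disjU stabU) := by
  have hα : ∀ i, ((gammaHeckeDatum X n).changeReps g).α i = (g i : GL (Fin 2) ℝ) * ((i.out : X.heckeSet n) : GL (Fin 2) ℝ) := fun i ↦ by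
    change (g i : GL (Fin 2) ℝ) * (gammaHeckeDatum X n).α i = _
    rw [gammaHeckeDatum_α]
  refine ⟨fun i ↦ ?_, fun a ha ↦ ?_⟩
  · rw [HeckeDatum.ofStable_α, hα]
    exact gamma_mul_mem_unitsHeckeSet_coverOrder X q (g i).2 (i.out : X.heckeSet n).2
  · obtain ⟨i, u, hu, h⟩ := hcov a ha
    exact ⟨i, u, hu, by rw [HeckeDatum.ofStable_α, hα]; exact h⟩

/-! ## §2 The two stubs (the r2 tree conjecture decls, by name) -/

/-- STUB (LIFT′, print; cite-conjunct grade): Armstrong + Eichler–Shimura (`H¹_P`, Shimura Thm. 8.4) + Deligne–Serre 6.11 + Jacquet–Langlands (`D > 1`) ∕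
Casselman + Atkin–Lehner on the compactified cover curve `X̄_{O₀'}`. [cite: ShimuraIATAF1971, Thm. 8.4] [cite: DeligneSerre1974, Lemme 6.11]
[cite: JacquetLanglands1970, §16] [cite: Casselman1973, Thm. 1] -/
theorem stub_cuspidalEigenCochainLiftPrimeToCartanPlaceAtThree : CartanCarayol.CuspidalEigenCochainLiftPrimeToCartanPlaceAtThree := by
  sorry

/-- STUB (EIG′, the certificate's output; the LEAD's glue (b) proves it from parts A–C + (SIMREP) + (CHEB) + RED_ℓ ∕ `ℙ¹(𝔽_ℓ)` cosets + (PAR, proved) —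
recipe in the
tree docstring of `CartanCarayol.PeriodCharacterCuspidalEigenPackageAtThree`; §1 supplies the datum clauses, p744112
`CartanCarayol.exists_eq_three_mul_of_isParabolic` the whole parabolic conjunct). [folklore] -/
theorem stub_periodCharacterCuspidalEigenPackageAtThree : CartanCarayol.PeriodCharacterCuspidalEigenPackageAtThree := by
  sorry

/-! ## §3 Composition by name (sorry-free given §2) -/

/-- CONG from the two stubs (tree: `CartanCarayol.congruentNewform_of_cuspLift`). -/
theorem congruentNewform_of_stubs : CartanCarayol.CongruentNewformOfLevelPrimeToCartanPlaceAtThree :=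
  CartanCarayol.congruentNewform_of_cuspLift stub_cuspidalEigenCochainLiftPrimeToCartanPlaceAtThree stub_periodCharacterCuspidalEigenPackageAtThree

/-- MOD from the stubs and Deligne–Serre Thm. 6.1 (named fact). -/
theorem modular_of_stubs (h61 : DeligneSerre1974.thm61_exists_adicGaloisRep) : CartanCarayol.ModularOfLevelPrimeToCartanPlaceAtThree :=
  CartanCarayol.modular_of_congruentNewform h61 congruentNewform_of_stubs

/-- CAR from the stubs (Carayol, tree: `CartanCarayol.carayol_of_modular`). -/
theorem carayol_of_stubs (h61 : DeligneSerre1974.thm61_exists_adicGaloisRep) : CartanCarayol.CarayolUnramifiedAtThree :=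
  CartanCarayol.carayol_of_modular (modular_of_stubs h61)

/-- **OBS from {thm61, LIFT′, EIG′}** — the Galois leaf of the LEAD's lattice line, by the tree theorem `noModThreePeriodCharacterExtension_of_cuspLift`. -/
theorem noModThreePeriodCharacterExtension_of_stubs (h61 : DeligneSerre1974.thm61_exists_adicGaloisRep) :
    CartanCover.Charext.NoModThreePeriodCharacterExtension :=
  CartanCarayol.noModThreePeriodCharacterExtension_of_cuspLift h61 stub_cuspidalEigenCochainLiftPrimeToCartanPlaceAtThree
    stub_periodCharacterCuspidalEigenPackageAtThree

/-- (D4) `SaturationAtThree` from (M), (M0) and the stubs. ((M0) is PROVED in the tree: `strongApproxAtCartanPlace_holds`, p739558.) -/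
theorem saturationAtThree_of_stubs (h61 : DeligneSerre1974.thm61_exists_adicGaloisRep) (hM : CartanCover.PeriodLatticeCharacter)
    (hM0 : CartanCover.Charext.StrongApproxAtCartanPlace) : CartanCover.SaturationAtThree :=
  CartanCarayol.saturationAtThree_of_cuspLift h61 hM hM0 stub_cuspidalEigenCochainLiftPrimeToCartanPlaceAtThree stub_periodCharacterCuspidalEigenPackageAtThree

end Summit.BirchSwinnertonDyer.BirchSwinnertonDyer.Cruxes.EulerHalvesAtThree.Carayol

end
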